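import Literature.NumberTheory.DiophantineGeometry.CongruenceLatticeBoxCount

-- Summit.ABC.ABC is the mandated summit-side namespace (single-conjunct summit); the lakefile sets the same option tree-wide.
set_option linter.dupNamespace false

/-!
# Lattice points of `{(a, b) : q ∣ a - λ b}` in a box when every nonzero lattice vector is long

Stub `de_latticeBox_card_le` of the DE tool for the line `critical-kloosterman-powerful-moduli`
of the crux `stmt-ABC-2757` (`Summit.ABC.ABC.Theses.TwistAmplification.MazurKaneLaw`): if every
nonzero vector of the index-`q` lattice `Λ = {(a, b) ∈ ℤ² : q ∣ a - λ b}` has sup-norm at least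
`M ≥ 1`, then `#(Λ ∩ [1, S]²) ≤ 20 S² / q + 4 S / M + 5` (`de_latticeBox_card_le`).

The proof is the elementary fibring argument of
`Literature.NumberTheory.DiophantineGeometry.card_box_filter_coprime_congr_le` (a gauge-minimal
nonzero lattice vector `b` of the box, fibres of `det(b, ·)`), run for a general congruence
lattice `{w : D ∣ v₁ w₁ + v₂ w₂}` with `gcd(v₁, v₂, D) = 1` in the symmetric box `[-N, N]²` but
without the primitivity filter: `#(Λ ∩ [-N, N]²) ≤ 20 N² / D + 4 N / M + 1`
(`de_card_symBox_filter_congr_le`); then `[1, S]² ⊆ [-S, S]²`.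
-/

namespace Summit.ABC.ABC.Theorems.MazurKaneLaw

open Finset
open Literature.NumberTheory.DiophantineGeometry
open Literature.NumberTheory.DiophantineGeometry.CongruenceLattice

-- adapted from Literature/NumberTheory/DiophantineGeometry/CongruenceLatticeBoxCount.lean
/-- **Points of a congruence lattice without short vectors in a symmetric box.** Let `D ≥ 1`,
`v₁, v₂ ∈ ℤ` with `gcd(v₁, v₂, D) = 1` and `M ≥ 1`, and suppose that every nonzero `w ∈ ℤ²`
with `D ∣ v₁ w₁ + v₂ w₂` satisfies `max(|w₁|, |w₂|) ≥ M`. Then for every `N ∈ ℕ`,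
`#{w ∈ [-N, N]² : D ∣ v₁ w₁ + v₂ w₂} ≤ 20 N² / D + 4 N / M + 1`. Fibring over `det(b, ·)` for a
gauge-minimal nonzero lattice vector `b` of the box (`m := N max(|b₁|, |b₂|)`, `N M ≤ m ≤ N²`):
at most `4 m / D + 1` fibres with at most `4 N² / m + 1` points each. [folklore] -/
theorem de_card_symBox_filter_congr_le {D : ℕ} (hD : 0 < D) {v₁ v₂ : ℤ}
    (hv : Nat.Coprime (Int.gcd v₁ v₂) D) {M : ℕ} (hM : 0 < M)
    (hlong : ∀ w : ℤ × ℤ, (D : ℤ) ∣ v₁ * w.1 + v₂ * w.2 → w ≠ 0 → (M : ℤ) ≤ max |w.1| |w.2|)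
    (N : ℕ) :
    ((((Icc (-(N : ℤ)) N ×ˢ Icc (-(N : ℤ)) N).filter
        (fun w => (D : ℤ) ∣ v₁ * w.1 + v₂ * w.2)).card : ℕ) : ℝ) ≤
      20 * (N : ℝ) ^ 2 / D + 4 * (N : ℝ) / M + 1 := by
  classical
  -- the box `R` and the lattice points `S` in it
  set R : Finset (ℤ × ℤ) := Icc (-(N : ℤ)) N ×ˢ Icc (-(N : ℤ)) N with hR
  set S : Finset (ℤ × ℤ) := R.filter (fun w => InL D v₁ v₂ w) with hS
  have hmemR : ∀ w : ℤ × ℤ, w ∈ R ↔ |w.1| ≤ N ∧ |w.2| ≤ N := by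
    intro w
    simp only [hR, mem_product, mem_Icc, abs_le]
  have hmemS : ∀ w : ℤ × ℤ, w ∈ S ↔ (|w.1| ≤ N ∧ |w.2| ≤ N) ∧ InL D v₁ v₂ w := by
    intro w; rw [hS, mem_filter, hmemR]
  have hSeq : R.filter (fun w => (D : ℤ) ∣ v₁ * w.1 + v₂ * w.2) = S := by
    ext w
    rw [mem_filter, hmemS, hmemR, InL]
  rw [hSeq]
  have hD' : (0 : ℝ) < D := by exact_mod_cast hD
  have hM' : (0 : ℝ) < M := by exact_mod_cast hM
  have h20 : (0 : ℝ) ≤ 20 * (N : ℝ) ^ 2 / D := by positivity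
  have h4 : (0 : ℝ) ≤ 4 * (N : ℝ) / M := by positivity
  -- if `S ⊆ {0}` the bound is trivial
  have hsmall : S ⊆ {0} → ((S.card : ℕ) : ℝ) ≤ 20 * (N : ℝ) ^ 2 / D + 4 * (N : ℝ) / M + 1 := by
    intro hsub
    have h1 : S.card ≤ 1 := (card_le_card hsub).trans (card_singleton _).le
    have h1' : (S.card : ℝ) ≤ 1 := by exact_mod_cast h1
    linarith
  /- degenerate box: `N = 0` -/
  rcases Nat.eq_zero_or_pos N with hN0 | hNpos
  · refine hsmall fun w hw => ?_
    obtain ⟨⟨h1, h2⟩, -⟩ := (hmemS w).mp hw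
    rw [hN0, Nat.cast_zero, abs_nonpos_iff] at h1 h2
    exact mem_singleton.mpr (Prod.ext h1 h2)
  /- no nonzero lattice point in the box -/
  set S' : Finset (ℤ × ℤ) := S.filter (fun w => w ≠ 0) with hS'
  rcases S'.eq_empty_or_nonempty with hS'e | hS'ne
  · refine hsmall fun w hw => ?_
    rw [mem_singleton]
    by_contra h0
    have hw' : w ∈ S' := by rw [hS', mem_filter]; exact ⟨hw, h0⟩
    rw [hS'e] at hw'
    simp at hw'
  /- a gauge-minimal nonzero vector `b` of `S` -/
  obtain ⟨b, hbS', hbmin⟩ := S'.exists_min_image (gauge N N) hS'ne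
  obtain ⟨hbS, hb0⟩ := mem_filter.mp hbS'
  obtain ⟨⟨hb1, hb2⟩, hbL⟩ := (hmemS b).mp hbS
  set m : ℕ := gauge N N b with hm
  -- `|b₁| N ≤ m`, `|b₂| N ≤ m`, `N M ≤ m ≤ N²`
  have hb1m : b.1.natAbs * N ≤ m := le_max_left _ _
  have hb2m : b.2.natAbs * N ≤ m := le_max_right _ _
  have hb1N : b.1.natAbs ≤ N := by
    have := hb1; rw [Int.abs_eq_natAbs] at this; exact_mod_cast this
  have hb2N : b.2.natAbs ≤ N := by
    have := hb2; rw [Int.abs_eq_natAbs] at this; exact_mod_cast this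
  have hmN : m ≤ N * N :=
    max_le (Nat.mul_le_mul_right _ hb1N) (Nat.mul_le_mul_right _ hb2N)
  have hmM : N * M ≤ m := by
    have h := hlong b hbL hb0
    rw [Int.abs_eq_natAbs, Int.abs_eq_natAbs] at h
    rcases le_max_iff.mp h with h1 | h1
    · have h2 : M ≤ b.1.natAbs := by exact_mod_cast h1
      calc N * M ≤ N * b.1.natAbs := Nat.mul_le_mul_left _ h2
        _ = b.1.natAbs * N := mul_comm _ _
        _ ≤ m := hb1m
    · have h2 : M ≤ b.2.natAbs := by exact_mod_cast h1
      calc N * M ≤ N * b.2.natAbs := Nat.mul_le_mul_left _ h2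
        _ = b.2.natAbs * N := mul_comm _ _
        _ ≤ m := hb2m
  have hm0 : 0 < m := lt_of_lt_of_le (Nat.mul_pos hNpos hM) hmM
  /- minimality: a vector of `Λ` parallel to `b` is an integer multiple of `b` -/
  have hpar : ∀ r : ℤ × ℤ, InL D v₁ v₂ r → det2 b r = 0 →
      ∃ q : ℤ, r.1 = q * b.1 ∧ r.2 = q * b.2 := by
    intro r hr hdet
    obtain ⟨t, ht1, ht2⟩ := exists_gcd_mul_eq_of_det2_eq_zero hb0 hdet
    set g : ℤ := (Int.gcd b.1 b.2 : ℤ) with hg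
    have hgpos : 0 < g := by
      rw [hg]; exact_mod_cast Int.gcd_pos_iff.mpr (by
        by_contra hcon; push Not at hcon; exact hb0 (Prod.ext hcon.1 hcon.2))
    set q : ℤ := t / g with hq
    set s : ℤ := t % g with hs
    have hts : g * q + s = t := Int.mul_ediv_add_emod t g
    have hs0 : 0 ≤ s := Int.emod_nonneg _ hgpos.ne'
    have hsg : s < g := Int.emod_lt_of_pos _ hgpos
    -- `u = r - q b` satisfies `g u = s b`
    set u : ℤ × ℤ := (r.1 - q * b.1, r.2 - q * b.2) with hu
    have hgu1 : g * u.1 = s * b.1 := by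
      simp only [hu]; linear_combination ht1 - b.1 * hts
    have hgu2 : g * u.2 = s * b.2 := by
      simp only [hu]; linear_combination ht2 - b.2 * hts
    rcases eq_or_lt_of_le hs0 with hs00 | hspos
    · -- `s = 0`: `u = 0`
      rw [← hs00, zero_mul] at hgu1 hgu2
      have hu1 : u.1 = 0 := (mul_eq_zero.mp hgu1).resolve_left hgpos.ne'
      have hu2 : u.2 = 0 := (mul_eq_zero.mp hgu2).resolve_left hgpos.ne'
      simp only [hu] at hu1 hu2
      exact ⟨q, by linarith, by linarith⟩
    · -- `0 < s < g`: `u` is a shorter nonzero vector of `S`, contradiction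
      exfalso
      have huL : InL D v₁ v₂ u := hr.sub_smul hbL q
      have habs1 : g * |u.1| = s * |b.1| := by
        rw [← abs_of_pos hgpos, ← abs_mul, hgu1, abs_mul, abs_of_pos hspos]
      have habs2 : g * |u.2| = s * |b.2| := by
        rw [← abs_of_pos hgpos, ← abs_mul, hgu2, abs_mul, abs_of_pos hspos]
      have hule1 : |u.1| ≤ |b.1| := by nlinarith [abs_nonneg u.1, abs_nonneg b.1]
      have hule2 : |u.2| ≤ |b.2| := by nlinarith [abs_nonneg u.2, abs_nonneg b.2]
      have huR : |u.1| ≤ N ∧ |u.2| ≤ N := ⟨hule1.trans hb1, hule2.trans hb2⟩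
      have hu0 : u ≠ 0 := by
        intro h0
        have h1 : u.1 = 0 ∧ u.2 = 0 := by rw [h0]; exact ⟨rfl, rfl⟩
        rw [h1.1, mul_zero] at hgu1
        rw [h1.2, mul_zero] at hgu2
        have hb1z : b.1 = 0 := (mul_eq_zero.mp hgu1.symm).resolve_left hspos.ne'
        have hb2z : b.2 = 0 := (mul_eq_zero.mp hgu2.symm).resolve_left hspos.ne'
        exact hb0 (Prod.ext hb1z hb2z)
      have huS' : u ∈ S' := by
        rw [hS', mem_filter, hmemS]
        exact ⟨⟨huR, huL⟩, hu0⟩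
      -- gauges: `g φ(u) = s φ(b) < g φ(b)`
      have hgg : (g.natAbs : ℕ) * gauge N N u = s.natAbs * gauge N N b := by
        rw [← gauge_mul, ← gauge_mul]
        simp only [hgu1, hgu2]
      have hlt : gauge N N u < gauge N N b := by
        have hsg' : s.natAbs < g.natAbs := by
          have := Int.natAbs_lt_natAbs_of_nonneg_of_lt hs0 hsg; exact this
        have hgpos' : 0 < g.natAbs := Int.natAbs_pos.mpr hgpos.ne'
        by_contra hge
        push Not at hge
        have h1 : s.natAbs * gauge N N b < g.natAbs * gauge N N b :=
          Nat.mul_lt_mul_of_pos_right hsg' hm0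
        have h2 : g.natAbs * gauge N N b ≤ g.natAbs * gauge N N u :=
          Nat.mul_le_mul_left _ hge
        omega
      exact absurd (hbmin u huS') (not_le.mpr hlt)
  /- fibres of `det(b, ·)` over `S` -/
  set T₀ : ℕ := 2 * N * N / m with hT₀
  have hfib : ∀ k : ℤ, (S.filter (fun p => det2 b p = k)).card ≤ 2 * T₀ + 1 := by
    intro k
    rcases (S.filter (fun p => det2 b p = k)).eq_empty_or_nonempty with he | ⟨q, hq⟩
    · rw [he, card_empty]; exact Nat.zero_le _
    obtain ⟨hqS, hqk⟩ := mem_filter.mp hq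
    obtain ⟨⟨hq1, hq2⟩, hqL⟩ := (hmemS q).mp hqS
    -- the parameter `t(p)` with `p - q = t b`
    let τ : ℤ × ℤ → ℤ := fun p => if b.1 ≠ 0 then (p.1 - q.1) / b.1 else (p.2 - q.2) / b.2
    have hτ : ∀ p ∈ S.filter (fun p => det2 b p = k),
        p.1 - q.1 = τ p * b.1 ∧ p.2 - q.2 = τ p * b.2 ∧ (τ p).natAbs ≤ T₀ := by
      intro p hp
      obtain ⟨hpS, hpk⟩ := mem_filter.mp hp
      obtain ⟨⟨hp1, hp2⟩, hpL⟩ := (hmemS p).mp hpS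
      have hrL : InL D v₁ v₂ (p.1 - 1 * q.1, p.2 - 1 * q.2) := hpL.sub_smul hqL 1
      simp only [one_mul] at hrL
      have hdet : det2 b (p.1 - q.1, p.2 - q.2) = 0 := by
        unfold det2 at hpk hqk ⊢; simp only; linear_combination hpk - hqk
      obtain ⟨t, ht1, ht2⟩ := hpar _ hrL hdet
      simp only at ht1 ht2
      have hτt : τ p = t := by
        simp only [τ]
        split_ifs with hb1z
        · rw [ht1, Int.mul_ediv_cancel _ hb1z]
        · push Not at hb1z
          have hb2z : b.2 ≠ 0 := fun h2 => hb0 (Prod.ext hb1z h2)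
          rw [ht2, Int.mul_ediv_cancel _ hb2z]
      rw [hτt]
      refine ⟨ht1, ht2, ?_⟩
      -- `|t| m = φ(t b) = φ(p - q) ≤ 2 N²`
      have hg1 : gauge N N (p.1 - q.1, p.2 - q.2) ≤ 2 * N * N := by
        refine (gauge_sub_le N N p q).trans ?_
        have hgp : gauge N N p ≤ N * N := by
          refine max_le ?_ ?_
          · have : p.1.natAbs ≤ N := by
              rw [Int.abs_eq_natAbs] at hp1; exact_mod_cast hp1
            exact Nat.mul_le_mul_right _ this
          · have : p.2.natAbs ≤ N := by
              rw [Int.abs_eq_natAbs] at hp2; exact_mod_cast hp2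
            exact Nat.mul_le_mul_right _ this
        have hgq : gauge N N q ≤ N * N := by
          refine max_le ?_ ?_
          · have : q.1.natAbs ≤ N := by
              rw [Int.abs_eq_natAbs] at hq1; exact_mod_cast hq1
            exact Nat.mul_le_mul_right _ this
          · have : q.2.natAbs ≤ N := by
              rw [Int.abs_eq_natAbs] at hq2; exact_mod_cast hq2
            exact Nat.mul_le_mul_right _ this
        linarith
      have hg2 : gauge N N (p.1 - q.1, p.2 - q.2) = t.natAbs * m := by
        rw [hm, ← gauge_mul]; simp only [ht1, ht2]
      rw [hg2] at hg1
      rw [hT₀, Nat.le_div_iff_mul_le hm0]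
      exact hg1
    refine (card_le_card_of_injOn (t := (Icc (-(T₀ : ℤ)) T₀ : Finset ℤ)) τ (fun p hp => ?_)
      (fun p hp p' hp' h => ?_)).trans ?_
    · -- lands in `Icc (-T₀) T₀`
      have h3 := (hτ p hp).2.2
      rw [mem_coe, mem_Icc, ← abs_le, Int.abs_eq_natAbs]
      exact_mod_cast h3
    · obtain ⟨h1, h2, -⟩ := hτ p hp
      obtain ⟨h1', h2', -⟩ := hτ p' hp'
      have e : τ p = τ p' := h
      refine Prod.ext ?_ ?_
      · linear_combination h1 - h1' + b.1 * e
      · linear_combination h2 - h2' + b.2 * e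
    · rw [Int.card_Icc]
      norm_num
      omega
  /- the values of `det(b, ·)` on `S` -/
  set K₀ : ℕ := 2 * m / D with hK₀
  have hdetS : ∀ p ∈ S, (det2 b p).natAbs ≤ 2 * m ∧ (D : ℤ) ∣ det2 b p := by
    intro p hp
    obtain ⟨⟨hp1, hp2⟩, hpL⟩ := (hmemS p).mp hp
    refine ⟨?_, dvd_det2 hv hbL hpL⟩
    have hp1' : p.1.natAbs ≤ N := by rw [Int.abs_eq_natAbs] at hp1; exact_mod_cast hp1
    have hp2' : p.2.natAbs ≤ N := by rw [Int.abs_eq_natAbs] at hp2; exact_mod_cast hp2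
    unfold det2
    calc (b.1 * p.2 - b.2 * p.1).natAbs ≤ (b.1 * p.2).natAbs + (b.2 * p.1).natAbs :=
          Int.natAbs_sub_le _ _
      _ = b.1.natAbs * p.2.natAbs + b.2.natAbs * p.1.natAbs := by
          rw [Int.natAbs_mul, Int.natAbs_mul]
      _ ≤ b.1.natAbs * N + b.2.natAbs * N :=
          add_le_add (Nat.mul_le_mul_left _ hp2') (Nat.mul_le_mul_left _ hp1')
      _ ≤ m + m := add_le_add hb1m hb2m
      _ = 2 * m := by ring
  have himage : S.image (det2 b) ⊆ (Icc (-(K₀ : ℤ)) K₀).image (fun k' => (D : ℤ) * k') := by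
    intro k hk
    obtain ⟨p, hp, rfl⟩ := mem_image.mp hk
    obtain ⟨hle, ⟨k', hk'⟩⟩ := hdetS p hp
    refine mem_image.mpr ⟨k', ?_, hk'.symm⟩
    rw [mem_Icc, ← abs_le, Int.abs_eq_natAbs]
    have h1 : D * k'.natAbs ≤ 2 * m := by
      rw [hk', Int.natAbs_mul, Int.natAbs_natCast] at hle; exact hle
    have h2 : k'.natAbs ≤ K₀ := by
      rw [hK₀, Nat.le_div_iff_mul_le hD, mul_comm]; exact h1
    exact_mod_cast h2
  have hcardK : (S.image (det2 b)).card ≤ 2 * K₀ + 1 := by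
    refine (card_le_card himage).trans (card_image_le.trans ?_)
    rw [Int.card_Icc]; norm_num; omega
  /- `#S ≤ (2K₀ + 1)(2T₀ + 1)` -/
  have hScard : S.card ≤ (2 * K₀ + 1) * (2 * T₀ + 1) := by
    rw [card_eq_sum_card_image (det2 b) S]
    refine (sum_le_sum (fun k _ => hfib k)).trans ?_
    rw [sum_const, smul_eq_mul]
    exact Nat.mul_le_mul_right _ hcardK
  /- real arithmetic: `(4m/D + 1)(4N²/m + 1) ≤ 20 N²/D + 4N/M + 1` as `N M ≤ m ≤ N²` -/
  have hm0' : (0 : ℝ) < m := by exact_mod_cast hm0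
  have hK₀le : (K₀ : ℝ) ≤ 2 * m / D := by
    rw [hK₀, le_div_iff₀ hD']; exact_mod_cast Nat.div_mul_le_self (2 * m) D
  have hT₀le : (T₀ : ℝ) ≤ 2 * N * N / m := by
    rw [hT₀, le_div_iff₀ hm0']; exact_mod_cast Nat.div_mul_le_self (2 * N * N) m
  have hmN' : (m : ℝ) ≤ N * N := by exact_mod_cast hmN
  have hmM' : (N : ℝ) * M ≤ m := by exact_mod_cast hmM
  have h1 : (S.card : ℝ) ≤ (2 * K₀ + 1) * (2 * T₀ + 1) := by exact_mod_cast hScard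
  have h2 : (2 * (K₀ : ℝ) + 1) * (2 * T₀ + 1) ≤ (4 * m / D + 1) * (4 * N * N / m + 1) := by
    have hK' : 2 * (K₀ : ℝ) + 1 ≤ 4 * m / D + 1 := by
      have : 2 * (2 * (m : ℝ) / D) = 4 * m / D := by ring
      linarith
    have hT' : 2 * (T₀ : ℝ) + 1 ≤ 4 * N * N / m + 1 := by
      have : 2 * (2 * (N : ℝ) * N / m) = 4 * N * N / m := by ring
      linarith
    exact mul_le_mul hK' hT' (by positivity) (by positivity)
  have h3 : (4 * (m : ℝ) / D + 1) * (4 * N * N / m + 1) =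
      16 * N * N / D + 4 * m / D + 4 * N * N / m + 1 := by
    field_simp
    ring
  have h5 : 4 * (m : ℝ) / D ≤ 4 * N * N / D := by
    rw [div_le_div_iff_of_pos_right hD']; linarith
  have h6 : 4 * (N : ℝ) * N / m ≤ 4 * N / M := by
    rw [div_le_div_iff₀ hm0' hM']
    have h7 : 4 * (N : ℝ) * (N * M) ≤ 4 * N * m :=
      mul_le_mul_of_nonneg_left hmM' (by positivity)
    linarith
  have h8 : (20 : ℝ) * N ^ 2 / D = 16 * N * N / D + 4 * N * N / D := by ring
  linarith

/-- **Lattice points in a box when every nonzero lattice vector is long.** For `q, M ≥ 1` and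
`λ ∈ ℤ`, if every nonzero `(a, b) ∈ ℤ²` with `q ∣ a - λ b` has `max(|a|, |b|) ≥ M`, then
`#{(a, b) ∈ [1, S]² : q ∣ a - λ b} ≤ 20 S² / q + 4 S / M + 5` (from
`de_card_symBox_filter_congr_le` with `D = q`, `(v₁, v₂) = (1, -λ)`, `N = S`, as
`[1, S]² ⊆ [-S, S]²`). [folklore] -/
theorem de_latticeBox_card_le : ∀ (q : ℕ) (lam : ℤ) (S M : ℕ), 0 < q → 0 < M → (∀ a b : ℤ, (q : ℤ) ∣ a - lam * b → (a, b) ≠ (0, 0) → (M : ℤ) ≤ max |a| |b|) → ((((Finset.Icc (1 : ℤ) S) ×ˢ (Finset.Icc (1 : ℤ) S)).filter (fun p : ℤ × ℤ => (q : ℤ) ∣ p.1 - lam * p.2)).card : ℝ) ≤ 20 * (S : ℝ) ^ 2 / q + 4 * (S : ℝ) / M + 5 := by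
  intro q lam S M hq hM hlong
  have hv : Nat.Coprime (Int.gcd 1 (-lam)) q := by
    rw [show Int.gcd 1 (-lam) = 1 by simp]
    exact Nat.gcd_one_left _
  have hlong' : ∀ w : ℤ × ℤ, (q : ℤ) ∣ 1 * w.1 + -lam * w.2 → w ≠ 0 →
      (M : ℤ) ≤ max |w.1| |w.2| := by
    intro w hw hw0
    refine hlong w.1 w.2 ?_ ?_
    · have e : 1 * w.1 + -lam * w.2 = w.1 - lam * w.2 := by ring
      rwa [e] at hw
    · intro h
      exact hw0 (Prod.ext (Prod.mk.inj h).1 (Prod.mk.inj h).2)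
  have hsub : (Finset.Icc (1 : ℤ) S ×ˢ Finset.Icc (1 : ℤ) S).filter
      (fun p : ℤ × ℤ => (q : ℤ) ∣ p.1 - lam * p.2) ⊆
      (Icc (-(S : ℤ)) S ×ˢ Icc (-(S : ℤ)) S).filter
        (fun w => (q : ℤ) ∣ 1 * w.1 + -lam * w.2) := by
    intro p hp
    rw [mem_filter, mem_product, mem_Icc, mem_Icc] at hp ⊢
    obtain ⟨⟨⟨h1, h2⟩, h3, h4⟩, hd⟩ := hp
    refine ⟨⟨⟨by linarith, h2⟩, by linarith, h4⟩, ?_⟩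
    have e : 1 * p.1 + -lam * p.2 = p.1 - lam * p.2 := by ring
    rwa [e]
  have h1 : ((((Finset.Icc (1 : ℤ) S) ×ˢ (Finset.Icc (1 : ℤ) S)).filter
      (fun p : ℤ × ℤ => (q : ℤ) ∣ p.1 - lam * p.2)).card : ℝ) ≤
      ((((Icc (-(S : ℤ)) S ×ˢ Icc (-(S : ℤ)) S).filter
        (fun w => (q : ℤ) ∣ 1 * w.1 + -lam * w.2)).card : ℕ) : ℝ) := by
    exact_mod_cast card_le_card hsub
  have h2 := de_card_symBox_filter_congr_le hq hv hM hlong' S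
  linarith

end Summit.ABC.ABC.Theorems.MazurKaneLaw
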